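import Mathlib
import Literature.NumberTheory.LFunctions.Zhang2022.Section17NNShiftError
import Literature.NumberTheory.LFunctions.Zhang2022.Section17NuOneStarTailSplit
import Literature.NumberTheory.LFunctions.Zhang2022.Section15ResidueNonvanishing
import HarnessLib

/-!
# Zhang (2022) §17: below the cutoff (`4v ≤ T²`), `ν₁*(v) = Σ_{a∣v, a≤D⁴} υ(a)τ₂(v/a) + O(δ·(ν²∗τ₂)(v))`,
# `δ = 10α𝓛^{11/10} + ½e^{−𝓛³⁰}`

Topic `Literature/NumberTheory/LFunctions/Zhang2022` (Landau–Siegel audit tree; verdict-neutral).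
Y. Zhang, *Discrete mean estimates and the Landau–Siegel zero*, arXiv:2211.02515v1 (2022)
[Zhang2022LandauSiegel] — **an unrefereed manuscript under adjudication**; nothing here asserts or denies
its Theorems 1–2. §17 p. 97 (u014, `ν₁* = υ·[≤D⁴] ∗ nN_{β₂} ∗ nN_{β₃}`), p. 98 (u021). Tools for the
§17.u021 remainder `R₁` (WP16 leaf h17_9; MEMO-R1-window §2(i), the range `m₂ ≤ T²/(4D⁴)` where "all
cutoffs `g ≡ 1` up to `e^{−𝓛³⁰}`"), decomposition-independent:

* `norm_nN_mul_nN_sub_one_le` — for `4k ≤ T²`, `bc = k`: `|nN₂(b)nN₃(c) − 1| ≤ 2δ`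
  (`δ = 10α𝓛^{11/10} + ½e^{−𝓛³⁰}`, `Section17NNShiftError`);
* `norm_conv_nN_nN_sub_tau_le` — `‖(nN₂ ∗ nN₃)(k) − τ₂(k)‖ ≤ 2δ·τ₂(k)` for `1 ≤ k`, `4k ≤ T²`;
* `norm_nuOneStar_sub_truncMain_le` — `‖ν₁*(v) − Σ_{v=ab, a≤D⁴} υ(a)τ₂(b)‖ ≤ 2δ·Σ_{v=ab, a≤D⁴}|ν(a)|²τ₂(b)`
  for `4v ≤ T²` (`|υ| ≤ ν²`, `Phi3Eval.norm_ups_le_norm_nu_sq`).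

Thresholds are explicit hypotheses (`3 ≤ 𝓛`, `|c′α𝓛| ≤ 1/14`, giving `|β₂|,|β₃| ≤ 5α` by the tree's
`ResidueValues.norm_beta2_le/norm_beta3_le`). Theorems only (no definitions, no named facts); axioms
standard. WHAT THIS IS NOT: a bound for `R₁`; any claim about Theorems 1–2 of the source.

## References

* Y. Zhang, arXiv:2211.02515v1 (2022), §17 pp. 97–98 (u014, u021); §4 (4.2).
  [cite: Zhang2022LandauSiegel, §17 u021 p.98]
-/

noncomputable section

open Complex Real Finset ArithmeticFunction
open Literature.NumberTheory.LFunctions.Zhang2022.Skeleton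
open Literature.NumberTheory.LFunctions.Zhang2022.Typed.Section17
open Literature.NumberTheory.LFunctions.Zhang2022.MeanSquareMajorant

namespace Literature.NumberTheory.LFunctions.Zhang2022.Phi3Eval

variable (c' : ℝ) {D : ℕ} (χ : DirichletCharacter ℂ D)

/-- **One product of cutoff factors**: for `𝓛 ≥ 3`, `|c′α𝓛| ≤ 1/14`, `b, c ≥ 1` with `4b, 4c ≤ T²`:
`|nN_{β₂}(b)·nN_{β₃}(c) − 1| ≤ 2δ`, `δ = 10α𝓛^{11/10} + ½e^{−𝓛³⁰}`. [cite: Zhang2022LandauSiegel, §17 u014 p.97] -/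
theorem norm_nN_mul_nN_sub_one_le (hℓ : 3 ≤ ell D) (hc : |c' * alpha D * ell D| ≤ 1 / 14)
    {b c : ℕ} (hb : b ≠ 0) (hc0 : c ≠ 0) (hbT : 4 * (b : ℝ) ≤ bigT D ^ 2) (hcT : 4 * (c : ℝ) ≤ bigT D ^ 2) :
    ‖nN D (beta2 c' D) b * nN D (beta3 c' D) c - 1‖ ≤
      2 * (10 * alpha D * ell D ^ (11 / 10 : ℝ) + (1 / 2 : ℝ) * Real.exp (-(ell D ^ 30))) := by
  set δ : ℝ := 10 * alpha D * ell D ^ (11 / 10 : ℝ) + (1 / 2 : ℝ) * Real.exp (-(ell D ^ 30)) with hδ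
  have hℓ1 : 1 ≤ ell D := by linarith
  have hℓ0 : 0 < ell D := by linarith
  have hβ2 : ‖beta2 c' D‖ ≤ 5 * alpha D := (ResidueValues.norm_beta2_le c' hℓ hc).trans (by
    linarith [(alpha_pos' hℓ0).le])
  have hβ3 : ‖beta3 c' D‖ ≤ 5 * alpha D := (ResidueValues.norm_beta3_le c' hℓ hc).trans (by
    linarith [(alpha_pos' hℓ0).le])
  have hβ2re : (beta2 c' D).re = 0 := by simp [beta2]
  have hβ3re : (beta3 c' D).re = 0 := by simp [beta3]
  have h2 := norm_nN_sub_one_le_of_four_mul_le hℓ1 hβ2re hβ2 hb hbT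
  have h3 := norm_nN_sub_one_le_of_four_mul_le hℓ1 hβ3re hβ3 hc0 hcT
  have hN2 : ‖nN D (beta2 c' D) b‖ ≤ 1 := Phi3TermByTerm.norm_nN_le_one hℓ0 hβ2re b
  rw [← hδ] at h2 h3
  have hδ0 : 0 ≤ δ := le_trans (norm_nonneg _) h2
  calc ‖nN D (beta2 c' D) b * nN D (beta3 c' D) c - 1‖
      = ‖nN D (beta2 c' D) b * (nN D (beta3 c' D) c - 1) + (nN D (beta2 c' D) b - 1)‖ := by ring_nf
    _ ≤ ‖nN D (beta2 c' D) b‖ * ‖nN D (beta3 c' D) c - 1‖ + ‖nN D (beta2 c' D) b - 1‖ := by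
        refine (norm_add_le _ _).trans (add_le_add ?_ le_rfl); rw [norm_mul]
    _ ≤ 1 * δ + δ := add_le_add (mul_le_mul hN2 h3 (norm_nonneg _) zero_le_one) h2
    _ = 2 * δ := by ring

/-- **`W = nN_{β₂} ∗ nN_{β₃} = τ₂ + O(δτ₂)` below the cutoff**: for `4k ≤ T²`,
`‖(nN_{β₂} ∗ nN_{β₃})(k) − τ₂(k)‖ ≤ 2δ·τ₂(k)`. [cite: Zhang2022LandauSiegel, §17 u014 p.97] -/
theorem norm_conv_nN_nN_sub_tau_le (hℓ : 3 ≤ ell D) (hc : |c' * alpha D * ell D| ≤ 1 / 14)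
    {k : ℕ} (hkT : 4 * (k : ℝ) ≤ bigT D ^ 2) :
    ‖LSeries.convolution (nN D (beta2 c' D)) (nN D (beta3 c' D)) k - (tau 2 k : ℂ)‖ ≤
      2 * (10 * alpha D * ell D ^ (11 / 10 : ℝ) + (1 / 2 : ℝ) * Real.exp (-(ell D ^ 30))) * tau 2 k := by
  classical
  set δ : ℝ := 10 * alpha D * ell D ^ (11 / 10 : ℝ) + (1 / 2 : ℝ) * Real.exp (-(ell D ^ 30)) with hδ
  have hτ : (tau 2 k : ℂ) = ∑ _x ∈ k.divisorsAntidiagonal, (1 : ℂ) := by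
    rw [← card_antidiag_eq_tau_two]; push_cast; rfl
  rw [LSeries.convolution_def, hτ]
  simp only
  rw [← Finset.sum_sub_distrib]
  refine (norm_sum_le _ _).trans ?_
  rw [← card_antidiag_eq_tau_two, Finset.mul_sum]
  refine Finset.sum_le_sum fun x hx => ?_
  rw [mul_one]
  obtain ⟨hx1, hx2, hb, hc0⟩ := bounds_of_mem_antidiag hx
  have hbk : (x.1 : ℝ) ≤ k := by exact_mod_cast hb
  have hck : (x.2 : ℝ) ≤ k := by exact_mod_cast hc0
  exact norm_nN_mul_nN_sub_one_le c' hℓ hc hx1 hx2 (by linarith) (by linarith)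

/-- **`ν₁*` against its truncated main part below the cutoff**: for `4v ≤ T²` and a real `χ`,
`‖ν₁*(v) − Σ_{v=ab, a≤D⁴} υ(a)τ₂(b)‖ ≤ 2δ·Σ_{v=ab, a≤D⁴} |ν(a)|²τ₂(b)` (`|υ| ≤ ν²`).
[cite: Zhang2022LandauSiegel, §17 u021 p.98] -/
theorem norm_nuOneStar_sub_truncMain_le (hq : χ.IsQuadratic) (hℓ : 3 ≤ ell D)
    (hc : |c' * alpha D * ell D| ≤ 1 / 14) {v : ℕ} (hvT : 4 * (v : ℝ) ≤ bigT D ^ 2) :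
    ‖nuOneStar c' χ v -
        ∑ q ∈ v.divisorsAntidiagonal with q.1 ≤ D ^ 4, ups χ q.1 * (tau 2 q.2 : ℂ)‖ ≤
      2 * (10 * alpha D * ell D ^ (11 / 10 : ℝ) + (1 / 2 : ℝ) * Real.exp (-(ell D ^ 30))) *
        ∑ q ∈ v.divisorsAntidiagonal with q.1 ≤ D ^ 4, ‖nu χ q.1‖ ^ 2 * tau 2 q.2 := by
  classical
  set δ : ℝ := 10 * alpha D * ell D ^ (11 / 10 : ℝ) + (1 / 2 : ℝ) * Real.exp (-(ell D ^ 30)) with hδ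
  set W := LSeries.convolution (nN D (beta2 c' D)) (nN D (beta3 c' D)) with hW
  -- `ν₁*(v) = Σ_{v=ab, a ≤ D⁴} υ(a) W(b)`
  have hassoc : nuOneStar c' χ = LSeries.convolution (trunc (D ^ 4) (ups χ)) W := by
    rw [nuOneStar, hW]
    show ⇑(toArithmeticFunction ⇑(toArithmeticFunction
        (trunc (D ^ 4) (ups χ)) * toArithmeticFunction (nN D (beta2 c' D))) *
        toArithmeticFunction (nN D (beta3 c' D))) =
      ⇑(toArithmeticFunction (trunc (D ^ 4) (ups χ)) *
        toArithmeticFunction ⇑(toArithmeticFunction (nN D (beta2 c' D)) *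
          toArithmeticFunction (nN D (beta3 c' D))))
    rw [ArithmeticFunction.toArithmeticFunction_eq_self,
      ArithmeticFunction.toArithmeticFunction_eq_self, mul_assoc]
  have hexp : nuOneStar c' χ v = ∑ q ∈ v.divisorsAntidiagonal with q.1 ≤ D ^ 4, ups χ q.1 * W q.2 := by
    rw [hassoc, LSeries.convolution_def]
    simp only
    rw [Finset.sum_filter]
    refine Finset.sum_congr rfl fun q _ => ?_
    simp only [trunc]
    split_ifs <;> simp
  rw [hexp, ← Finset.sum_sub_distrib, Finset.mul_sum]
  refine (norm_sum_le _ _).trans (Finset.sum_le_sum fun q hqm => ?_)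
  have hq' := (Finset.mem_filter.1 hqm).1
  obtain ⟨hq1, hq2, _, hq2v'⟩ := bounds_of_mem_antidiag hq'
  have hq2v : (q.2 : ℝ) ≤ v := by exact_mod_cast hq2v'
  have hWτ := norm_conv_nN_nN_sub_tau_le c' hℓ hc (k := q.2) (by linarith)
  rw [← hW, ← hδ] at hWτ
  rw [← mul_sub, norm_mul]
  have hδ0 : 0 ≤ 2 * δ * tau 2 q.2 := le_trans (norm_nonneg _) hWτ
  calc ‖ups χ q.1‖ * ‖W q.2 - (tau 2 q.2 : ℂ)‖ ≤ ‖nu χ q.1‖ ^ 2 * (2 * δ * tau 2 q.2) :=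
        mul_le_mul (norm_ups_le_norm_nu_sq χ hq q.1) hWτ (norm_nonneg _) (by positivity)
    _ = 2 * δ * (‖nu χ q.1‖ ^ 2 * tau 2 q.2) := by ring

end Literature.NumberTheory.LFunctions.Zhang2022.Phi3Eval
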